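import Mathlib
import Summits.NavierStokesRegularity.NavierStokesRegularity.Theorems.HeteroclinicTriggerChainTriggerChainFrontStepForcedIgnition
import Summits.NavierStokesRegularity.NavierStokesRegularity.Theorems.HeteroclinicTriggerChainTriggerChainFrontStepForcedTransfer
import HarnessLib

/-!
# `HeteroclinicTriggerChain` — crux `TriggerChainFrontStep` (item stmt-NavierStokesRegularity-22785):
  ONE HOP of the forced arc — ignition, crossing of equal split, exponential capture (composed)

The analytic core of blueprint item 2 in one statement, for the forced arc `D′ = −2e·u² + f₁`,
`u′ = e·D·u + f₂` on a window `[0,T]` (one-sided derivatives; `|f₁| ≤ φ₁ ≤ φ`, `|f₂| ≤ φ₂ ≤ φ`),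
composed from `…ForcedIgnition` (delay law ⇒ first ignition time `τ ≤ T₁`), a TIME SHIFT of the arc to
`τ` (`htcFH_shift_hasDerivWithinAt`), and `…ForcedTransfer` (envelope-free radius bound ⇒ equal split by
`τ + D₊/(2em−φ)` ⇒ no return ⇒ exponential capture). Conclusion of `heteroclinicTriggerChain_forcedArcOn_hop`:
there are `τ ∈ (0,T₁]` (ignition: `u(τ) = h`, `|u| < h` before) and `t₀ ∈ [τ, τ + max 0 (D₊/(2em−φ))]`
with `D ≤ 0` on `[t₀,T]` and `D(t) + ρ₋ ≤ ρ₋·e^{−eρ₋(t−t₀)} + φ/(eρ₋)` there. On the lattice the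
remainders `f₁, f₂` and their bounds are supplied by `…LatticeDelay` (`htcLD_front_block_forced₂`), so
this is the hop of an exact flow of the pinned table modulo the envelope supply.

HONEST FRAMING: elementary real analysis of a planar ODE with bounded forcing on a segment; helper lemma
for the crux (no stub credit); nothing here is a statement about the Navier–Stokes equations; no summit,
rung or crux is proved by this file.
-/

noncomputable section

set_option linter.dupNamespace false

open Real Set

namespace Summit.NavierStokesRegularity.NavierStokesRegularity.Theorems

/-- Time shift of a one-sided derivative statement on a segment: if `F′ = G` on `[0,T]` (within) and
`0 ≤ τ`, then `s ↦ F(τ+s)` has derivative `G(τ+s)` within `[0, T−τ]`. [folklore] -/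
theorem htcFH_shift_hasDerivWithinAt {F G : ℝ → ℝ} {T τ : ℝ} (hτ : 0 ≤ τ)
    (hF : ∀ t ∈ Icc 0 T, HasDerivWithinAt F (G t) (Icc 0 T) t) :
    ∀ s ∈ Icc 0 (T - τ), HasDerivWithinAt (fun r => F (τ + r)) (G (τ + s)) (Icc 0 (T - τ)) s := by
  intro s hs
  have hmem : τ + s ∈ Icc 0 T := ⟨by linarith [hs.1], by linarith [hs.2]⟩
  have hmaps : MapsTo (fun r : ℝ => τ + r) (Icc 0 (T - τ)) (Icc 0 T) := fun r hr =>
    ⟨by linarith [hr.1], by linarith [hr.2]⟩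
  have hshift : HasDerivWithinAt (fun r : ℝ => τ + r) 1 (Icc 0 (T - τ)) s :=
    ((hasDerivAt_id s).const_add τ).hasDerivWithinAt
  have h := (hF (τ + s) hmem).comp s hshift hmaps
  rw [mul_one] at h
  exact h

/-- **One hop of the forced arc** (ignition + transfer, composed). See the module docstring for the
reading; hypotheses: the arc on `[0,T]`, forcing bounds `φ₁, φ₂ ≤ φ`; delay data `0 < D₋ ≤ D(0) −
(2eh²+φ₁)T`, `D(0) + φ₁T ≤ D₊`, `φ₂/(eD₋) < u(0)`, `|u(0)| < h`, `h ≤ (u(0) − φ₂/(eD₋))e^{eD₋T₁}`,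
`0 ≤ T₁ ≤ T`; transfer data `D₊² + 2h² ≤ ρ₀²`, `M = ρ₀ + √3φT`, `φ < 2em`, `2m + 6MφT ≤ 2h²`,
`T₁ + D₊/(2em−φ) ≤ T`, `0 < ρ₋`, `ρ₋² + 6MφT ≤ D₋² + 2h²`, `φ < eρ₋²`. [this file] -/
theorem heteroclinicTriggerChain_forcedArcOn_hop {e φ φ₁ φ₂ h Dm Dp T T₁ ρ₀ ρm M m : ℝ}
    {D u f₁ f₂ : ℝ → ℝ} (he : 0 < e) (hT₁ : 0 ≤ T₁) (hT₁T : T₁ ≤ T)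
    (hD : ∀ t ∈ Icc 0 T, HasDerivWithinAt D (-(2 * e * u t ^ 2) + f₁ t) (Icc 0 T) t)
    (hu : ∀ t ∈ Icc 0 T, HasDerivWithinAt u (e * D t * u t + f₂ t) (Icc 0 T) t)
    (hf₁ : ∀ t ∈ Icc 0 T, |f₁ t| ≤ φ₁) (hf₂ : ∀ t ∈ Icc 0 T, |f₂ t| ≤ φ₂)
    (hφ₁φ : φ₁ ≤ φ) (hφ₂φ : φ₂ ≤ φ)
    (hDm : 0 < Dm) (hDmle : Dm ≤ D 0 - (2 * e * h ^ 2 + φ₁) * T) (hDp : D 0 + φ₁ * T ≤ Dp)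
    (hfl : φ₂ / (e * Dm) < u 0) (huh0 : |u 0| < h)
    (hreach : h ≤ (u 0 - φ₂ / (e * Dm)) * Real.exp (e * Dm * T₁))
    (hρ₀ : 0 ≤ ρ₀) (hρ₀ge : Dp ^ 2 + 2 * h ^ 2 ≤ ρ₀ ^ 2) (hM : M = ρ₀ + Real.sqrt 3 * φ * T)
    (hφm : φ < 2 * e * m) (hm : 2 * m + 6 * M * φ * T ≤ 2 * h ^ 2)
    (hTw : T₁ + Dp / (2 * e * m - φ) ≤ T)
    (hρm : 0 < ρm) (hρmQ : ρm ^ 2 + 6 * M * φ * T ≤ Dm ^ 2 + 2 * h ^ 2) (hφρ : φ < e * ρm ^ 2) :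
    ∃ τ ∈ Ioc 0 T₁, u τ = h ∧ (∀ t ∈ Ico 0 τ, |u t| < h) ∧
      ∃ t₀ ∈ Icc τ (τ + max 0 (Dp / (2 * e * m - φ))), D t₀ ≤ 0 ∧
        ∀ t ∈ Icc t₀ T, D t ≤ 0 ∧ D t + ρm ≤ ρm * Real.exp (-(e * ρm * (t - t₀))) + φ / (e * ρm) := by
  have hγ : 0 < 2 * e * m - φ := by linarith
  have hT : 0 ≤ T := hT₁.trans hT₁T
  have hφ₁ : 0 ≤ φ₁ := (abs_nonneg _).trans (hf₁ 0 ⟨le_rfl, hT⟩)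
  have hφ : 0 ≤ φ := hφ₁.trans hφ₁φ
  have hDp0 : 0 ≤ Dp := by
    have h1 : 0 ≤ (2 * e * h ^ 2 + φ₁) * T := by positivity
    have h2 : 0 ≤ φ₁ * T := by positivity
    linarith
  have hDpd : 0 ≤ Dp / (2 * e * m - φ) := div_nonneg hDp0 hγ.le
  have h3 : 0 ≤ Real.sqrt 3 := Real.sqrt_nonneg _
  have hM0 : 0 ≤ M := by rw [hM]; positivity
  -- ignition
  obtain ⟨τ, hτ, huτ, hbefore, hpin, -⟩ :=
    heteroclinicTriggerChain_forcedArcOn_ignition_time he hT₁ hT₁T hD hu hf₁ hf₂ hDm hDmle hDp hfl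
      huh0 hreach
  have hτ0 : 0 ≤ τ := hτ.1.le
  have hτT : τ ≤ T := hτ.2.trans hT₁T
  have hDτ := hpin τ (right_mem_Icc.2 hτ0)
  refine ⟨τ, hτ, huτ, hbefore, ?_⟩
  -- the shifted arc on [0, T - τ]
  have hD' := htcFH_shift_hasDerivWithinAt (F := D) hτ0 hD
  have hu' := htcFH_shift_hasDerivWithinAt (F := u) hτ0 hu
  have hT' : 0 ≤ T - τ := by linarith
  have hf₁' : ∀ s ∈ Icc 0 (T - τ), |f₁ (τ + s)| ≤ φ := fun s hs =>
    (hf₁ (τ + s) ⟨by linarith [hs.1], by linarith [hs.2]⟩).trans hφ₁φ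
  have hf₂' : ∀ s ∈ Icc 0 (T - τ), |f₂ (τ + s)| ≤ φ := fun s hs =>
    (hf₂ (τ + s) ⟨by linarith [hs.1], by linarith [hs.2]⟩).trans hφ₂φ
  -- data of the transfer lemma at the ignition state
  have hQ0' : D (τ + 0) ^ 2 + 2 * u (τ + 0) ^ 2 ≤ ρ₀ ^ 2 := by
    rw [add_zero, huτ]
    have : D τ ^ 2 ≤ Dp ^ 2 := pow_le_pow_left₀ (hDm.le.trans hDτ.1) hDτ.2 2
    linarith
  set M' : ℝ := ρ₀ + Real.sqrt 3 * φ * (T - τ) with hM'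
  have hM'le : M' ≤ M := by
    have : 0 ≤ Real.sqrt 3 * φ * τ := mul_nonneg (mul_nonneg h3 hφ) hτ0
    rw [hM', hM]; linarith
  have hM'0 : 0 ≤ M' := by rw [hM']; positivity
  have hdrift' : 6 * M' * φ * (T - τ) ≤ 6 * M * φ * T := by
    have h1 : 6 * M' * φ * (T - τ) ≤ 6 * M' * φ * T :=
      mul_le_mul_of_nonneg_left (by linarith) (by positivity)
    have h2 : 6 * M' * φ * T ≤ 6 * M * φ * T := by
      have h := mul_le_mul_of_nonneg_right hM'le (by positivity : 0 ≤ 6 * φ * T)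
      have e1 : 6 * M' * φ * T = M' * (6 * φ * T) := by ring
      have e2 : 6 * M * φ * T = M * (6 * φ * T) := by ring
      rw [e1, e2]; exact h
    linarith
  have hu0' : 2 * m + 6 * M' * φ * (T - τ) ≤ 2 * u (τ + 0) ^ 2 := by
    rw [add_zero, huτ]; linarith
  have hTT' : D (τ + 0) / (2 * e * m - φ) ≤ T - τ := by
    rw [add_zero]
    have : D τ / (2 * e * m - φ) ≤ Dp / (2 * e * m - φ) :=
      div_le_div_of_nonneg_right hDτ.2 hγ.le
    linarith [hτ.2]
  have hρmQ' : ρm ^ 2 + 6 * M' * φ * (T - τ) ≤ D (τ + 0) ^ 2 + 2 * u (τ + 0) ^ 2 := by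
    rw [add_zero, huτ]
    have : Dm ^ 2 ≤ D τ ^ 2 := pow_le_pow_left₀ hDm.le hDτ.1 2
    linarith
  obtain ⟨s₀, hs₀, hDs₀, hafter⟩ :=
    heteroclinicTriggerChain_forcedArcOn_transfer (D := fun r => D (τ + r)) (u := fun r => u (τ + r))
      he hT' hρ₀ hD' hu' hf₁' hf₂' hQ0' hM' hφm hu0' hTT' hρm hρmQ' hφρ
  rw [add_zero] at hs₀
  refine ⟨τ + s₀, ⟨by linarith [hs₀.1], ?_⟩, hDs₀, fun t ht => ?_⟩
  · have : max 0 (D τ / (2 * e * m - φ)) ≤ max 0 (Dp / (2 * e * m - φ)) :=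
      max_le_max le_rfl (div_le_div_of_nonneg_right hDτ.2 hγ.le)
    linarith [hs₀.2]
  · have hs : t - τ ∈ Icc s₀ (T - τ) := ⟨by linarith [ht.1], by linarith [ht.2]⟩
    have h := hafter (t - τ) hs
    have e1 : τ + (t - τ) = t := by ring
    have e2 : t - τ - s₀ = t - (τ + s₀) := by ring
    rw [e1, e2] at h
    exact h

end Summit.NavierStokesRegularity.NavierStokesRegularity.Theorems

end
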